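import Mathlib
import Literature.NumberTheory.Transcendental.ZagierDilogarithmConjecture
import Literature.NumberTheory.Transcendental.BlochWignerDilogarithm
import Literature.NumberTheory.Transcendental.BlochWignerDilogarithmProofs
import Literature.NumberTheory.Transcendental.PreBlochRelationCriterion
import Literature.NumberTheory.Transcendental.BlochGroupRegulator
import Summits.KontsevichZagierPeriods.KontsevichZagierPeriods.Theorems.ZagierDilogarithmConjecture.Negative.DehnInvariant
import Summits.KontsevichZagierPeriods.KontsevichZagierPeriods.Theorems.HyperbolicBlochZagierDilogarithmConjectureStubAbelianSectorIff
import Summits.KontsevichZagierPeriods.KontsevichZagierPeriods.Theorems.HyperbolicBlochZagierDilogarithmConjectureStubAbelianPropagation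
import HarnessLib

/-!
# `ZagierDilogarithmConjecture` (stmt-KontsevichZagierPeriods-10550) — line `kummer-clausen-linearisation`
(reshape c5, "the cyclotomic tower and the abelian sector"), stub `stub_abelianSector_iff_milnor`

**The Dehn-zero sector of Zagier's conjecture over the cyclotomic field `ℚ(ζ_N)` is EQUIVALENT to
Milnor's conjecture at level `N` — given Dupont's relation criterion and Borel's rank theorem.**
Notation: `ζ = ζ_N = e^{2πi/N}`, `D` the Bloch–Wigner dilogarithm (`blochWignerDilog`),
`R̄ = ⟨dilogRelators⟩ ⊆ ℤ[ℂ]` the relator group of Zagier's dilogarithm conjecture (Neumann 1998, §2.1),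
`dehn u v : ℤ[ℂ] → ℚ` the Dehn-type invariants of `Negative/DehnInvariant` (anti-symmetrised Bloch
symbol paired with two `ℚ`-characters `u, v` of `ℂˣ`).

* *Dehn-zero sector over `ℚ(ζ_N)`*: every `ℤ`-relation `Σ nᵢ D(zᵢ) = 0` among cyclotomic points
  `zᵢ = Σₘ qᵢₘ ζᵐ ∈ ℍ⁺` (`qᵢₘ ∈ ℚ`) whose formal combination `Σ nᵢ[zᵢ]` has all Dehn invariants zero
  is explained: `Σ nᵢ[zᵢ] ∈ R̄`.
* *Milnor_N* (`ℤ`-form; Milnor 1982, Appendix): the primitive Clausen values `D(ζ^c)`, `(c, N) = 1`,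
  `0 < c < N/2`, admit only the trivial `ℤ`-relation.

**Theorem.** GIVEN (1) Dupont's criterion `Dupont2001_preBloch_relation_of_invariants` (Dupont 2001,
Thm. 10.24 a)) and (2) Borel's rank theorem for the Bloch group `Borel1977_blochGroup_rank_le`
(`dim_ℚ B(F) ⊗ ℚ ≤ r₂(F)`, Neumann 1998, Thm. 3.2) — two named printed facts, carried as explicit
hypotheses and never unfolded — the two statements are equivalent for every `N ≥ 1`.

Proof: a pure composition of two landed theorems of this line. `stub_abelianSector_iff` proves the
equivalence from Dupont's criterion and ABELIAN PROPAGATION (for every level: Milnor_N ⇒ every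
Dehn-zero relation among cyclotomic points of `ℍ⁺` propagates to all Galois twists
`Σ nᵢ (D(σ zᵢ) − D(σ z̄ᵢ)) = 0`, `σ : ℚ̄ → ℂ`), and the lead's `stub_abelianPropagation` proves abelian
propagation from Borel's rank theorem (rank count in `ℚ(ζ_N)`: `r₂ = φ(N)/2` primitive Clausen classes
plus the relation itself are dependent modulo torsion in `P(ℚ(ζ_N))`; Milnor_N isolates the relation).
Sorry-free; axioms ⊆ {propext, Classical.choice, Quot.sound}; conditional only on the two explicit
antecedents.

## References

* W. D. Neumann, *Hilbert's 3rd problem and invariants of 3-manifolds*, Geom. Topol. Monogr. 1 (1998),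
  §2.1 and Thm. 3.2. [Neumann1998]
* J. Milnor, *Hyperbolic geometry: the first 150 years*, Bull. AMS 6 (1982), Appendix (the conjecture
  on the values `Л(πc/N)`). [Milnor1982]
* J. L. Dupont, *Scissors congruences, group homology and characteristic classes*, World Scientific
  (2001), Thm. 10.24 a). [Dupont2001]
-/

noncomputable section

open scoped BigOperators ComplexConjugate
open Literature.NumberTheory.Transcendental
open Summit.KontsevichZagierPeriods.HyperbolicBloch.ZagierDilogarithmConjectureNegative (dehn)

namespace Summit.KontsevichZagierPeriods.HyperbolicBloch.ZagierDilogarithmCyclotomic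

/-- **Stub `stub_abelianSector_iff_milnor` (c5 wave 3): the Dehn-zero sector of Zagier's conjecture over
`ℚ(ζ_N)` is EQUIVALENT to Milnor's conjecture at level `N`, modulo Dupont's criterion (Dupont 2001,
Thm. 10.24 a)) and Borel's rank theorem for the Bloch group (Neumann 1998, Thm. 3.2).** For every
`N ≥ 1`: [every `ℤ`-relation `Σ nᵢ D(zᵢ) = 0` among cyclotomic points `zᵢ = Σₘ qᵢₘ ζ_Nᵐ` of the open
upper half plane whose formal combination `Σ nᵢ[zᵢ]` has all Dehn invariants `dehn u v` zero satisfies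
`Σ nᵢ[zᵢ] ∈ ⟨dilogRelators⟩`] if and only if [the primitive Clausen values `D(ζ_N^c)`, `c ∈ (ℤ/N)ˣ`,
`0 < c < N/2`, are `ℤ`-linearly independent]. Composition of `stub_abelianSector_iff` (the equivalence
modulo Dupont and abelian propagation) with `stub_abelianPropagation` (abelian propagation from Borel's
rank theorem). [cite: Milnor1982, Appendix] -/
theorem stub_abelianSector_iff_milnor :
    Dupont2001_preBloch_relation_of_invariants → Borel1977_blochGroup_rank_le →
    ∀ (N : ℕ) [NeZero N],
      (∀ (k : ℕ) (z : Fin k → ℂ) (n : Fin k → ℤ) (q : Fin k → Fin N → ℚ),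
          (∀ i, z i = ∑ m : Fin N, (q i m : ℂ) * Complex.exp (2 * Real.pi * Complex.I / N) ^ (m : ℕ)) →
          (∀ i, 0 < (z i).im) →
          (∀ u v : Additive ℂˣ →+ ℚ, dehn u v (∑ i, n i • FreeAbelianGroup.of (z i)) = 0) →
          ∑ i, (n i : ℝ) * blochWignerDilog (z i) = 0 →
            (∑ i, n i • FreeAbelianGroup.of (z i)) ∈ AddSubgroup.closure dilogRelators) ↔
        (∀ m : ZMod N → ℤ, (∀ c, m c ≠ 0 → IsUnit c ∧ 0 < c.val ∧ 2 * c.val < N) →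
          ∑ c : ZMod N, (m c : ℝ) *
              blochWignerDilog (Complex.exp (2 * Real.pi * Complex.I / N) ^ c.val) = 0 →
            ∀ c, m c = 0) :=
  fun hD hB N _ => stub_abelianSector_iff hD (stub_abelianPropagation hB) N

end Summit.KontsevichZagierPeriods.HyperbolicBloch.ZagierDilogarithmCyclotomic

end
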